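import Mathlib
import Summits.QuantumFields.YangMills.Theorems.IsotropyFromPowerCountingCurvatureSandwichBoundChainEngine
import HarnessLib

/-!
# `CurvatureSandwichBound` (Σ), line `Sketch`: the SUM ENGINE (iterated Schwarz on finite combinations)

Support file for crux stmt-QuantumFields-18372 (`IsotropyFromPowerCounting.CurvatureSandwichBound`), registered
skeleton `Cruxes/CurvatureSandwichBound/Lines/Sketch.lean`, stub `stub_sumEngine` (model-blind).

Fix a one-species family `T` on `ℝ⁴` with an `e₀`-reconstruction `h : OSReconstructionNoE1 T.toLabelled`, a windowed
insertion `f₁` (`tsupport f₁ ⊆ {u ≤ x⁰ ≤ 2u}`), `s = 2u + v`, the sandwich `X G := f₁ ⊗ T_s G` and the chain step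
`P G = T_s (f₁† ⊗ f₁ ⊗ T_s G)` on `Σ m, 𝓢((ℝ⁴)^m)` (a variable `P` with its defining equation `hP`).

* `inner_iterate₂`: the two-ended collapse `⟪Ψ_{P^i A}, Ψ_{P^j B}⟫ = ⟪Ψ_A, Ψ_{P^{i+j} B}⟫` (from `inner_P_symm`,
  exactly as the one-ended `inner_iterate`).
* `inner_sum_smul_sum_smul`, `re_sum_sum_le`: finite-sum bookkeeping (sesquilinearity; the pairwise bound
  `ΣΣ |cᵢ||cⱼ| aᵢ aⱼ L = (Σ |cᵢ| aᵢ)² L`).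
* `stub_sumEngine` (**the sum engine**): for finitely many admissible generators `Gᵢ` with PAIRWISE chain-moment
  bounds `|𝔖(ΘGᵢ* ⊗ P^N Gⱼ)| ≤ aᵢ aⱼ Λ^{2N}`, `‖Σ cᵢ Ψ_{X Gᵢ}‖ ≤ Λ ‖Σ cᵢ Ψ_{Gᵢ}‖`: with `x = Σ cᵢ Ψ_{Gᵢ}`,
  `y = Σ cᵢ Ψ_{X Gᵢ}`, `p_n = Σ cᵢ Ψ_{P^n Gᵢ}` one has `‖y‖² = Re⟪x, p₁⟫` (`stub_sandwichAdjoint`),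
  `‖p_n‖² = Re⟪x, p_{2n}⟫` (`inner_iterate₂`) and `Re⟪x, p_{2n}⟫ ≤ (Σ|cᵢ|aᵢ)² Λ^{4n}`
  (`inner_fieldVec_fieldVec` + the pairwise bounds), then the abstract iterated Schwarz bound `stub_iterSchwarz`.

This is the multi-vector form of `sandwich_of_chainGrowth` (Glimm–Jaffe 1987, Thm 10.5.5, multiple reflections);
no Yang–Mills content.
-/

noncomputable section

namespace Summit.QuantumFields.YangMills.Theorems.CurvatureSandwichBound.Sketch

open scoped BigOperators SchwartzMap InnerProductSpace
open MeasureTheory Filter Topology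
open Literature.MathematicalPhysics.QuantumLattice Literature.MathematicalPhysics.AQFT
  Literature.MathematicalPhysics.QuantumFieldTheory Literature.Probability.LatticeModels
open Summit.QuantumFields.YangMills.Theorems.NPointIsotropy.Negative (E4)

/-! ## Finite-sum bookkeeping -/

/-- Sesquilinear expansion of an inner product of two finite combinations with the same coefficients:
`⟪Σ cᵢ fᵢ, Σ cⱼ gⱼ⟫ = ΣΣ c̄ᵢ cⱼ ⟪fᵢ, gⱼ⟫`. -/
theorem inner_sum_smul_sum_smul {H : Type*} [NormedAddCommGroup H] [InnerProductSpace ℂ H]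
    {ι : Type*} (s : Finset ι) (c : ι → ℂ) (f g : ι → H) :
    ⟪∑ i ∈ s, c i • f i, ∑ j ∈ s, c j • g j⟫_ℂ =
      ∑ i ∈ s, ∑ j ∈ s, (starRingEnd ℂ) (c i) * c j * ⟪f i, g j⟫_ℂ := by
  rw [sum_inner]
  refine Finset.sum_congr rfl fun i _ => ?_
  rw [inner_sum]
  refine Finset.sum_congr rfl fun j _ => ?_
  rw [inner_smul_left, inner_smul_right, ← mul_assoc]

/-- The pairwise bound summed: if `|tᵢⱼ| ≤ aᵢ aⱼ L` then `Re ΣΣ c̄ᵢ cⱼ tᵢⱼ ≤ (Σ |cᵢ| aᵢ)² L`. -/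
theorem re_sum_sum_le {k : ℕ} (c : Fin k → ℂ) (a : Fin k → ℝ) (t : Fin k → Fin k → ℂ) (L : ℝ)
    (ht : ∀ i j, ‖t i j‖ ≤ a i * a j * L) :
    (∑ i, ∑ j, (starRingEnd ℂ) (c i) * c j * t i j).re ≤ (∑ i, ‖c i‖ * a i) ^ 2 * L := by
  calc (∑ i, ∑ j, (starRingEnd ℂ) (c i) * c j * t i j).re
      ≤ ‖∑ i, ∑ j, (starRingEnd ℂ) (c i) * c j * t i j‖ := Complex.re_le_norm _
    _ ≤ ∑ i, ‖∑ j, (starRingEnd ℂ) (c i) * c j * t i j‖ := norm_sum_le _ _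
    _ ≤ ∑ i, ∑ j, ‖(starRingEnd ℂ) (c i) * c j * t i j‖ :=
        Finset.sum_le_sum fun i _ => norm_sum_le _ _
    _ = ∑ i, ∑ j, ‖c i‖ * ‖c j‖ * ‖t i j‖ := by simp only [norm_mul, Complex.norm_conj]
    _ ≤ ∑ i, ∑ j, ‖c i‖ * ‖c j‖ * (a i * a j * L) := by
        gcongr with i _ j _
        exact ht i j
    _ = (∑ i, ‖c i‖ * a i) ^ 2 * L := by
        rw [sq, Finset.sum_mul_sum, Finset.sum_mul]
        refine Finset.sum_congr rfl fun i _ => ?_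
        rw [Finset.sum_mul]
        exact Finset.sum_congr rfl fun j _ => by ring

/-! ## The two-ended chain collapse -/

/-- **Chain inner products collapse to one end (two generators)**:
`⟪Ψ_{P^i A}, Ψ_{P^j B}⟫ = ⟪Ψ_A, Ψ_{P^{i+j} B}⟫` for admissible `A`, `B` (induction on `i` with `inner_P_symm`). -/
theorem inner_iterate₂ (S : SchwingerFamily E4) (h : OSReconstructionNoE1 S.toLabelled)
    (u v : ℝ) (hu : 0 < u) (hv : 0 < v) (f₁ : 𝓢((Fin 1 → E4), ℂ))
    (hf₁ : tsupport (f₁ : (Fin 1 → E4) → ℂ) ⊆ {x | u ≤ x 0 0 ∧ x 0 0 ≤ 2 * u})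
    (P : (Σ m : ℕ, 𝓢((Fin m → E4), ℂ)) → (Σ m : ℕ, 𝓢((Fin m → E4), ℂ)))
    (hP : P = fun Gσ => ⟨1 + (1 + Gσ.1), translateMulti ((2 * u + v) • EuclideanSpace.single 0 1)
      ((osAdjoint f₁).appendTensor
        (f₁.appendTensor (translateMulti ((2 * u + v) • EuclideanSpace.single 0 1) Gσ.2)))⟩)
    (A B : Σ m : ℕ, 𝓢((Fin m → E4), ℂ)) (hA : IsTimeOrdered A.2)
    (hXA : IsTimeOrdered
      (f₁.appendTensor (translateMulti ((2 * u + v) • EuclideanSpace.single 0 1) A.2)))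
    (hB : IsTimeOrdered B.2)
    (hXB : IsTimeOrdered
      (f₁.appendTensor (translateMulti ((2 * u + v) • EuclideanSpace.single 0 1) B.2)))
    (i j : ℕ) :
    ⟪h.fieldVec (P^[i] A).1 (fun _ => ()) (P^[i] A).2
        (adm_iterate' u v hu hv f₁ hf₁ P hP i A hA hXA).1,
      h.fieldVec (P^[j] B).1 (fun _ => ()) (P^[j] B).2
        (adm_iterate' u v hu hv f₁ hf₁ P hP j B hB hXB).1⟫_ℂ =
    ⟪h.fieldVec A.1 (fun _ => ()) A.2 hA,
      h.fieldVec (P^[i + j] B).1 (fun _ => ()) (P^[i + j] B).2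
        (adm_iterate' u v hu hv f₁ hf₁ P hP (i + j) B hB hXB).1⟫_ℂ := by
  induction i generalizing j with
  | zero =>
    congr 1
    exact fieldVec_sigma_congr h (by rw [Nat.zero_add]) _ _
  | succ i ih =>
    -- `P^[i+1] A = P (P^[i] A)` and `P (P^[j] B) = P^[j+1] B`
    have hi : P^[i + 1] A = P (P^[i] A) := Function.iterate_succ_apply' P i A
    have hj : P (P^[j] B) = P^[j + 1] B := (Function.iterate_succ_apply' P j B).symm
    have hij : P^[i + (j + 1)] B = P^[i + 1 + j] B := by rw [Nat.add_right_comm, Nat.add_assoc]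
    have hAi := adm_iterate' u v hu hv f₁ hf₁ P hP i A hA hXA
    have hBj := adm_iterate' u v hu hv f₁ hf₁ P hP j B hB hXB
    have hPAi : IsTimeOrdered (P (P^[i] A)).2 :=
      hi ▸ (adm_iterate' u v hu hv f₁ hf₁ P hP (i + 1) A hA hXA).1
    have hPBj : IsTimeOrdered (P (P^[j] B)).2 :=
      hj ▸ (adm_iterate' u v hu hv f₁ hf₁ P hP (j + 1) B hB hXB).1
    rw [fieldVec_sigma_congr h hi _ hPAi,
      inner_P_symm S h (2 * u + v) f₁ P hP (P^[i] A) (P^[j] B) hAi.1 hBj.1 hAi.2 hBj.2 hPAi hPBj,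
      fieldVec_sigma_congr h hj hPBj (adm_iterate' u v hu hv f₁ hf₁ P hP (j + 1) B hB hXB).1, ih (j + 1),
      fieldVec_sigma_congr h hij _ _]

/-! ## The sum engine -/

/-- **Stub (SE) — THE SUM ENGINE (model-blind: iterated Schwarz on finite combinations).**  For any one-species
family `T` with an `e₀`-reconstruction `h`, a windowed insertion `f₁` (`[u,2u]`), `s = 2u+v`, the chain step `P`, and a
finite family of admissible generators `Gᵢ` with PAIRWISE chain-moment bounds
`|𝔖(ΘGᵢ* ⊗ P^N Gⱼ)| ≤ aᵢ aⱼ Λ^{2N}` (all `N`), the sandwich is bounded by `Λ` on the combination: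
`‖Σ cᵢ Ψ_{f₁ ⊗ T_s Gᵢ}‖ ≤ Λ ‖Σ cᵢ Ψ_{Gᵢ}‖`.  Proof: `x = Σ cᵢΨ_{Gᵢ}`, `y = Σ cᵢΨ_{XGᵢ}`, `p_n = Σ cᵢ Ψ_{P^n Gᵢ}`
(admissible by `adm_iterate'`); `‖y‖² = Re⟪x, p₁⟫` and `‖p_n‖² = Re⟪x, p_{2n}⟫` by sesquilinearity from
`stub_sandwichAdjoint` / `inner_iterate₂`, and `Re⟪x, p_{2n}⟫ ≤ (Σ|cᵢ|aᵢ)² Λ^{4n}` by the pairwise bounds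
(`inner_fieldVec_fieldVec`); then `stub_iterSchwarz` (Glimm–Jaffe 1987, Thm 10.5.5). -/
theorem stub_sumEngine :
    ∀ (T : SchwingerFamily E4) (h : OSReconstructionNoE1 T.toLabelled) (u v : ℝ), 0 < u → 0 < v →
    ∀ (f₁ : 𝓢((Fin 1 → E4), ℂ)),
      tsupport (f₁ : (Fin 1 → E4) → ℂ) ⊆ {x | u ≤ x 0 0 ∧ x 0 0 ≤ 2 * u} →
    ∀ (P : (Σ m : ℕ, 𝓢((Fin m → E4), ℂ)) → (Σ m : ℕ, 𝓢((Fin m → E4), ℂ))),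
      (P = fun Gσ => ⟨1 + (1 + Gσ.1), translateMulti ((2 * u + v) • EuclideanSpace.single 0 1)
        ((osAdjoint f₁).appendTensor
          (f₁.appendTensor (translateMulti ((2 * u + v) • EuclideanSpace.single 0 1) Gσ.2)))⟩) →
    ∀ (Λ : ℝ), 0 ≤ Λ →
    ∀ (k : ℕ) (G : Fin k → Σ m : ℕ, 𝓢((Fin m → E4), ℂ)) (hG : ∀ i, IsTimeOrdered (G i).2)
      (hXG : ∀ i, IsTimeOrdered
        (f₁.appendTensor (translateMulti ((2 * u + v) • EuclideanSpace.single 0 1) (G i).2)))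
      (a : Fin k → ℝ),
      (∀ i, 0 ≤ a i) →
      (∀ (i j : Fin k) (N : ℕ),
        ‖T ((G i).1 + (P^[N] (G j)).1) ((osAdjoint (G i).2).appendTensor (P^[N] (G j)).2)‖ ≤
          a i * a j * Λ ^ (2 * N)) →
    ∀ (c : Fin k → ℂ),
      ‖∑ i, c i • h.fieldVec (1 + (G i).1) (fun _ => ())
          (f₁.appendTensor (translateMulti ((2 * u + v) • EuclideanSpace.single 0 1) (G i).2)) (hXG i)‖ ≤
        Λ * ‖∑ i, c i • h.fieldVec (G i).1 (fun _ => ()) (G i).2 (hG i)‖ := by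
  intro T h u v hu hv f₁ hf₁ P hP Λ hΛ k G hG hXG a ha hT c
  -- admissibility of every iterate of every generator
  have hadm : ∀ (i : Fin k) (n : ℕ), IsTimeOrdered (P^[n] (G i)).2 ∧
      IsTimeOrdered (f₁.appendTensor
        (translateMulti ((2 * u + v) • EuclideanSpace.single 0 1) (P^[n] (G i)).2)) :=
    fun i n => adm_iterate' u v hu hv f₁ hf₁ P hP n (G i) (hG i) (hXG i)
  -- the chain vectors `q i n = Ψ_{P^n Gᵢ}` and their combinations `p n = Σ cᵢ q i n` (`p 0 = x`)
  let q : Fin k → ℕ → h.Hilbert := fun i n =>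
    h.fieldVec (P^[n] (G i)).1 (fun _ => ()) (P^[n] (G i)).2 (hadm i n).1
  let p : ℕ → h.Hilbert := fun n => ∑ i, c i • q i n
  have hp0 : p 0 = ∑ i, c i • h.fieldVec (G i).1 (fun _ => ()) (G i).2 (hG i) := rfl
  -- two-ended collapse and the chain moments as Schwinger function values
  have hij : ∀ (i j : Fin k) (n m : ℕ), ⟪q i n, q j m⟫_ℂ = ⟪q i 0, q j (n + m)⟫_ℂ := fun i j n m =>
    inner_iterate₂ T h u v hu hv f₁ hf₁ P hP (G i) (G j) (hG i) (hXG i) (hG j) (hXG j) n m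
  have hinner : ∀ (i j : Fin k) (n : ℕ), ⟪q i 0, q j n⟫_ℂ =
      T ((G i).1 + (P^[n] (G j)).1) ((osAdjoint (G i).2).appendTensor (P^[n] (G j)).2) :=
    fun i j n => h.inner_fieldVec_fieldVec (fun _ => ()) (fun _ => ()) (hG i) (hadm j n).1
      (isAppendTensorOf_appendTensor _ _)
  -- `⟪p n, p m⟫ = ⟪p 0, p (n + m)⟫`
  have hpp : ∀ n m : ℕ, ⟪p n, p m⟫_ℂ = ⟪p 0, p (n + m)⟫_ℂ := fun n m => by
    show ⟪∑ i, c i • q i n, ∑ j, c j • q j m⟫_ℂ = ⟪∑ i, c i • q i 0, ∑ j, c j • q j (n + m)⟫_ℂ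
    rw [inner_sum_smul_sum_smul, inner_sum_smul_sum_smul]
    exact Finset.sum_congr rfl fun i _ => Finset.sum_congr rfl fun j _ => by rw [hij i j n m]
  -- `⟪p 0, p n⟫` as a double sum of chain moments
  have hp0n : ∀ n : ℕ, ⟪p 0, p n⟫_ℂ = ∑ i, ∑ j, (starRingEnd ℂ) (c i) * c j *
      T ((G i).1 + (P^[n] (G j)).1) ((osAdjoint (G i).2).appendTensor (P^[n] (G j)).2) := fun n => by
    show ⟪∑ i, c i • q i 0, ∑ j, c j • q j n⟫_ℂ = _
    rw [inner_sum_smul_sum_smul]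
    exact Finset.sum_congr rfl fun i _ => Finset.sum_congr rfl fun j _ => by rw [hinner i j n]
  -- `‖p n‖² = Re ⟪p 0, p (2n)⟫`
  have hnorm : ∀ n : ℕ, ‖p n‖ ^ 2 = (⟪p 0, p (2 * n)⟫_ℂ).re := fun n => by
    rw [two_mul, ← hpp n n, ← inner_self_eq_norm_sq (𝕜 := ℂ) (p n)]
    rfl
  -- the first chain step written out, and `q j 1 = Ψ_{P Gⱼ}` in that form
  have hP1 : ∀ j : Fin k, P^[1] (G j) = ⟨1 + (1 + (G j).1),
      translateMulti ((2 * u + v) • EuclideanSpace.single 0 1)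
        ((osAdjoint f₁).appendTensor
          (f₁.appendTensor (translateMulti ((2 * u + v) • EuclideanSpace.single 0 1) (G j).2)))⟩ :=
    fun j => by rw [Function.iterate_one, hP]
  have hPG : ∀ j : Fin k, IsTimeOrdered (translateMulti ((2 * u + v) • EuclideanSpace.single 0 1)
      ((osAdjoint f₁).appendTensor
        (f₁.appendTensor (translateMulti ((2 * u + v) • EuclideanSpace.single 0 1) (G j).2)))) :=
    fun j => by
      have hh := (hadm j 1).1
      rw [hP1 j] at hh
      exact hh
  have hq1 : ∀ j : Fin k, q j 1 = h.fieldVec (1 + (1 + (G j).1)) (fun _ => ())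
      (translateMulti ((2 * u + v) • EuclideanSpace.single 0 1)
        ((osAdjoint f₁).appendTensor
          (f₁.appendTensor (translateMulti ((2 * u + v) • EuclideanSpace.single 0 1) (G j).2))))
      (hPG j) := fun j => fieldVec_sigma_congr h (hP1 j) _ _
  -- the sandwich adjoint identity, pairwise: `⟪Ψ_{XGᵢ}, Ψ_{XGⱼ}⟫ = ⟪q i 0, q j 1⟫`
  have hXX : ∀ i j : Fin k,
      ⟪h.fieldVec (1 + (G i).1) (fun _ => ())
          (f₁.appendTensor (translateMulti ((2 * u + v) • EuclideanSpace.single 0 1) (G i).2)) (hXG i),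
        h.fieldVec (1 + (G j).1) (fun _ => ())
          (f₁.appendTensor (translateMulti ((2 * u + v) • EuclideanSpace.single 0 1) (G j).2)) (hXG j)⟫_ℂ =
      ⟪q i 0, q j 1⟫_ℂ := fun i j => by
    rw [hq1 j]
    exact stub_sandwichAdjoint T h (2 * u + v) f₁ (G i).2 (G j).2 (hG i) (hXG i) (hXG j) (hPG j)
  -- `‖y‖² = Re ⟪p 0, p 1⟫`
  have hyy : ⟪∑ i, c i • h.fieldVec (1 + (G i).1) (fun _ => ())
          (f₁.appendTensor (translateMulti ((2 * u + v) • EuclideanSpace.single 0 1) (G i).2)) (hXG i),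
        ∑ j, c j • h.fieldVec (1 + (G j).1) (fun _ => ())
          (f₁.appendTensor (translateMulti ((2 * u + v) • EuclideanSpace.single 0 1) (G j).2)) (hXG j)⟫_ℂ =
      ⟪p 0, p 1⟫_ℂ := by
    show _ = ⟪∑ i, c i • q i 0, ∑ j, c j • q j 1⟫_ℂ
    rw [inner_sum_smul_sum_smul, inner_sum_smul_sum_smul]
    exact Finset.sum_congr rfl fun i _ => Finset.sum_congr rfl fun j _ => by rw [hXX i j]
  have hy : ‖∑ i, c i • h.fieldVec (1 + (G i).1) (fun _ => ())
        (f₁.appendTensor (translateMulti ((2 * u + v) • EuclideanSpace.single 0 1) (G i).2)) (hXG i)‖ ^ 2 =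
      (⟪p 0, p 1⟫_ℂ).re := by
    rw [← hyy, ← inner_self_eq_norm_sq (𝕜 := ℂ)]
    rfl
  -- the three inputs of the abstract iterated Schwarz bound
  have hre : ∀ n : ℕ, (⟪p 0, p n⟫_ℂ).re ≤ ‖p 0‖ * ‖p n‖ := fun n => by
    simpa only [RCLike.re_to_complex] using re_inner_le_norm (𝕜 := ℂ) (p 0) (p n)
  have H1 : ‖∑ i, c i • h.fieldVec (1 + (G i).1) (fun _ => ())
        (f₁.appendTensor (translateMulti ((2 * u + v) • EuclideanSpace.single 0 1) (G i).2)) (hXG i)‖ ^ 2 ≤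
      ‖p 0‖ * ‖p 1‖ := hy ▸ hre 1
  have H2 : ∀ n : ℕ, ‖p n‖ ^ 2 ≤ ‖p 0‖ * ‖p (2 * n)‖ := fun n => (hnorm n) ▸ hre (2 * n)
  have hC : 0 ≤ ∑ i, ‖c i‖ * a i := Finset.sum_nonneg fun i _ => mul_nonneg (norm_nonneg _) (ha i)
  have H3 : ∀ n : ℕ, ‖p n‖ ≤ (∑ i, ‖c i‖ * a i) * Λ ^ (2 * n) := fun n => by
    have hsq : ‖p n‖ ^ 2 ≤ ((∑ i, ‖c i‖ * a i) * Λ ^ (2 * n)) ^ 2 := by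
      rw [hnorm n, hp0n (2 * n)]
      calc _ ≤ (∑ i, ‖c i‖ * a i) ^ 2 * Λ ^ (2 * (2 * n)) :=
            re_sum_sum_le c a
              (fun i j => T ((G i).1 + (P^[2 * n] (G j)).1)
                ((osAdjoint (G i).2).appendTensor (P^[2 * n] (G j)).2))
              (Λ ^ (2 * (2 * n))) (fun i j => hT i j (2 * n))
        _ = ((∑ i, ‖c i‖ * a i) * Λ ^ (2 * n)) ^ 2 := by ring
    exact (sq_le_sq₀ (norm_nonneg _) (mul_nonneg hC (pow_nonneg hΛ _))).mp hsq
  have key := stub_iterSchwarz (p 0) _ p (∑ i, ‖c i‖ * a i) Λ hC hΛ H1 H2 H3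
  rwa [hp0] at key

end Summit.QuantumFields.YangMills.Theorems.CurvatureSandwichBound.Sketch

end
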